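/-
Copyright: the b2b-balaban T⁴-continuum CRUX team, row NE7b OWNER lineage `t4-ne7b-p1` (gen 130). Project licence.
-/
import Mathlib.Analysis.Calculus.MeanValue
import Mathlib.Analysis.Calculus.Deriv.MeanValue
import Mathlib.Analysis.Calculus.Deriv.Pow

/-!
# A MIXED DERIVATIVE IS CONTROLLED BY MIXED DIFFERENCES AND THIRD DERIVATIVES: for `f : ℝ → ℝ → ℝ` with `∂_sf, ∂_s²f` everywhere and
# `∂_t∂_sf(0,·), ∂_t²∂_sf(0,·)`, if the mixed second differences are small, `|f(r₁,t) − f(r₁,0) − f(0,t) + f(0,0)| ≤ B` (`0 ≤ t ≤ 1`), and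
# `|∂_s²f| ≤ M₂` on the square, `|∂_t²∂_sf(0,·)| ≤ M₃` on `[0,1]`, then for all `0 < r₁, r₂ ≤ 1`
#   `|∂_t∂_sf(0,0)| ≤ (B∕r₁ + M₂r₁)∕r₂ + ½M₃r₂`
# (optimising, `|∂_t∂_sf(0,0)| ≲ B^{1∕4}M₂^{1∕4}M₃^{1∕2}`) — twice the one-variable extraction `|g'(0)| ≤ B∕r + ½Mr` of a derivative from an
# increment and a second-derivative bound — the real-variable device turning (326)'s exponentially small mixed DIFFERENCES of `log Z(s,t)`
# into an exponentially small tilted COVARIANCE `∂_s∂_t log Z(0,0) = Cov_ν(F_y, G_z)` (row NE7b, node U5c; Mathlib only; [folklore])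

Cell `pub-balaban`, sub-cell `t4`, spine estimate NE7b (`T4WeightBudget.RelWeightBound`; the cell's OWN estimate — NOT PRINTED in
[Bałaban 1983–89], NOT PROVED).  Crux-route work under `Spine/NE7b/` by the row OWNER (`t4-ne7b-p1` gen 130, file (327)) under FREEZE
(0)'s crux-prover clause, on § [NE7bP1-G129-HANDOFF] NEXT (i)∕(ii) (SCOPING-d4: differences → derivative); NOTHING of Bałaban's is named
as a Lean object, valued or asserted; no `T4Continuum/Support` leaf typed; no `def`, no notation; zero `sorry`.  Mathlib only
(`norm_image_sub_le_of_norm_deriv_le_segment'`, `Convex.image_sub_le_mul_sub_of_deriv_le`, `HasDerivAt` algebra).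

WHY (located).  (324)∕(326) bound the mixed second difference of the small-field free energy under two far-apart one-site perturbations by
`B = O(e^{−η(n+1)}ε̃)` uniformly in the perturbation sizes, NOT bilinearly in them; the covariance is the mixed DERIVATIVE at the origin.  A
function with small increments can still have a large derivative unless its higher derivatives are controlled — and for `log Z(s,t)`
they are: its `(s,t)`-derivatives are tilted cumulants of the one-site observables, bounded volume-uniformly through single-site moments
((323)).  The present file is the calculus that combines the two: no analyticity, no complex parameters.

WHAT IS PROVED ([folklore]):
* §1 ONE VARIABLE: `abs_sub_sub_mul_le` (`|g'(x) − g'(0)| ≤ M|x|`-type MVT for `g'`), **`abs_deriv_le_of_increment`** (`g ∈ C²` in the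
  `HasDerivAt` sense, `0 < r`, `|g(r) − g(0)| ≤ B`, `|g''| ≤ M` on `[0,r]` ⟹ `|g'(0)| ≤ B∕r + ½Mr`);
* §2 TWO VARIABLES, THE END **`abs_mixedDeriv_le_of_differences`** (displayed above); §3 toy;
* §4 LOCAL VERSIONS (gen 130 addendum): `abs_sub_sub_mul_le_on`, **`abs_deriv_le_of_increment_on`**, **`abs_mixedDeriv_le_of_differences_on`**
  — the same with the differentiability letters asked only on `[0,r]` (resp. `[0,r₁] × [0,1]`, `[0,1]`), the form in which the exponential
  family (330) supplies them (its letter covers `|s|, |t| ≤ 1` only).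

HONEST (what this is NOT).  Calculus only; the identification of the `(s,t)`-derivatives of `log Z(s,t)` with tilted cumulants and their
volume-uniform bounds (dominated differentiation in the scalar parameters + (323)'s moments for the perturbed families) are the successor's
remaining steps of SCOPING-d4; nothing of Bałaban's asserted.  BY-NAME EFFECT ON THE WALL: NONE.  NE7b NOT PRINTED ∕ NOT PROVED; spine
PROVED 0∕9; rung (B)+1 — the programme's measures remain FINITE-torus statements; NOT the mass gap, NOT Clay.  HONEST DEPENDENCY: continuum
YM on T⁴ ⇐ BetaPertH ∧ nine spine estimates (0∕9 proved); BetaPertH ⇐ (D1) ∧ (D4) ∧ CAP+tail; G-an2-4 gates asym, D1 and NE2∕3∕4.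
-/

set_option autoImplicit false

namespace Summit.QuantumFields.BalabanUV.T4Continuum.NE7b.SupMixedDerivativeFromDifferences

open Set

/-! ## §1. One variable: a derivative from an increment and a second-derivative bound -/

/-- **MVT for the derivative**: `g'` with derivative `g''`, `|g''| ≤ M` on `[0,r]` ⟹ `|g'(x) − g'(0)| ≤ M·x` for `x ∈ [0,r]`. [folklore] -/
theorem abs_sub_sub_mul_le {g' g'' : ℝ → ℝ} (hg' : ∀ x, HasDerivAt g' (g'' x) x) {M r : ℝ} (hM : ∀ x ∈ Icc (0 : ℝ) r, |g'' x| ≤ M)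
    {x : ℝ} (hx : x ∈ Icc (0 : ℝ) r) : |g' x - g' 0| ≤ M * x := by
  have h := norm_image_sub_le_of_norm_deriv_le_segment' (f := g') (f' := g'') (a := 0) (b := x)
    (fun y _ => (hg' y).hasDerivWithinAt) (fun y hy => by
      rw [Real.norm_eq_abs]
      exact hM y ⟨hy.1, hy.2.le.trans hx.2⟩) x (right_mem_Icc.2 hx.1)
  rw [Real.norm_eq_abs, sub_zero] at h
  exact h

/-- **A DERIVATIVE FROM AN INCREMENT**: `g` with `HasDerivAt g (g' x) x` and `HasDerivAt g' (g'' x) x` everywhere, `0 < r`, `|g(r) − g(0)| ≤ B`,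
`|g''| ≤ M` on `[0,r]` ⟹ `|g'(0)| ≤ B∕r + ½M·r` (compare `g` with its tangent at `0` corrected by `±½Mx²`). [folklore] -/
theorem abs_deriv_le_of_increment {g g' g'' : ℝ → ℝ} (hg : ∀ x, HasDerivAt g (g' x) x) (hg' : ∀ x, HasDerivAt g' (g'' x) x) {r B M : ℝ}
    (hr : 0 < r) (hB : |g r - g 0| ≤ B) (hM : ∀ x ∈ Icc (0 : ℝ) r, |g'' x| ≤ M) : |g' 0| ≤ B / r + M * r / 2 := by
  have hD : Convex ℝ (Icc (0 : ℝ) r) := convex_Icc 0 r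
  have hint : interior (Icc (0 : ℝ) r) = Ioo 0 r := interior_Icc
  -- `ψ(x) = g x − g 0 − x·g'(0) − ½Mx²` is non-increasing, `χ(x) = g x − g 0 − x·g'(0) + ½Mx²` non-decreasing on `[0,r]`
  have hsq : ∀ x : ℝ, HasDerivAt (fun x : ℝ => M * x ^ 2 / 2) (M * x) x := fun x =>
    (((hasDerivAt_pow 2 x).const_mul M).div_const 2).congr_deriv (by
      rw [show (2 : ℕ) - 1 = 1 from rfl, pow_one]
      push_cast
      ring)
  have hψd : ∀ x, HasDerivAt (fun x => g x - g 0 - x * g' 0 - M * x ^ 2 / 2) (g' x - g' 0 - M * x) x := fun x =>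
    ((((hg x).sub_const (g 0)).sub ((hasDerivAt_id' x).mul_const (g' 0))).sub (hsq x)).congr_deriv (by ring)
  have hχd : ∀ x, HasDerivAt (fun x => g x - g 0 - x * g' 0 + M * x ^ 2 / 2) (g' x - g' 0 + M * x) x := fun x =>
    ((((hg x).sub_const (g 0)).sub ((hasDerivAt_id' x).mul_const (g' 0))).add (hsq x)).congr_deriv (by ring)
  have hdev : ∀ x ∈ Ioo (0 : ℝ) r, |g' x - g' 0| ≤ M * x := fun x hx => abs_sub_sub_mul_le hg' hM ⟨hx.1.le, hx.2.le⟩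
  have hψ := hD.image_sub_le_mul_sub_of_deriv_le (f := fun x => g x - g 0 - x * g' 0 - M * x ^ 2 / 2)
    (fun x _ => (hψd x).continuousAt.continuousWithinAt) (fun x _ => (hψd x).differentiableAt.differentiableWithinAt) (C := 0)
    (fun x hx => by
      rw [hint] at hx
      rw [(hψd x).deriv]
      linarith [(abs_le.1 (hdev x hx)).2])
    0 (left_mem_Icc.2 hr.le) r (right_mem_Icc.2 hr.le) hr.le
  have hχ := hD.mul_sub_le_image_sub_of_le_deriv (f := fun x => g x - g 0 - x * g' 0 + M * x ^ 2 / 2)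
    (fun x _ => (hχd x).continuousAt.continuousWithinAt) (fun x _ => (hχd x).differentiableAt.differentiableWithinAt) (C := 0)
    (fun x hx => by
      rw [hint] at hx
      rw [(hχd x).deriv]
      linarith [(abs_le.1 (hdev x hx)).1])
    0 (left_mem_Icc.2 hr.le) r (right_mem_Icc.2 hr.le) hr.le
  simp only [sub_self, zero_mul, mul_zero, zero_pow two_ne_zero, zero_div, sub_zero, add_zero] at hψ hχ
  -- `hψ : g r − g 0 − r g'(0) − ½Mr² ≤ 0`, `hχ : 0 ≤ g r − g 0 − r g'(0) + ½Mr²`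
  have hB1 := (abs_le.1 hB).1
  have hB2 := (abs_le.1 hB).2
  have hr0 : r ≠ 0 := hr.ne'
  have e : (B + M * r ^ 2 / 2) / r = B / r + M * r / 2 := by
    field_simp
  rw [abs_le, ← e]
  constructor
  · -- `−(B/r + Mr/2) ≤ g'(0)` from `r g'(0) ≥ g r − g 0 − ½Mr² ≥ −B − ½Mr²`
    rw [neg_le, le_div_iff₀ hr]
    linarith
  · rw [le_div_iff₀ hr]
    linarith

/-! ## §2. THE END: two variables -/

/-- **THE END — A MIXED DERIVATIVE FROM MIXED DIFFERENCES AND DERIVATIVE BOUNDS.**  `f : ℝ → ℝ → ℝ` with `∂_sf = fs` and `∂_s fs = fss`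
everywhere, `∂_t(fs 0 ·) = fst` and `∂_t fst = fstt` everywhere; `0 < r₁`, `0 < r₂ ≤ 1`; mixed differences
`|f(r₁,t) − f(r₁,0) − f(0,t) + f(0,0)| ≤ B` for `t ∈ [0,1]`; `|fss| ≤ M₂` on `[0,r₁] × [0,1]`; `|fstt| ≤ M₃` on `[0,1]` ⟹
`|fst 0| ≤ (B∕r₁ + M₂r₁)∕r₂ + ½M₃r₂`. [folklore] -/
theorem abs_mixedDeriv_le_of_differences {f fs fss : ℝ → ℝ → ℝ} {fst fstt : ℝ → ℝ} (hfs : ∀ s t, HasDerivAt (fun s => f s t) (fs s t) s)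
    (hfss : ∀ s t, HasDerivAt (fun s => fs s t) (fss s t) s) (hfst : ∀ t, HasDerivAt (fun t => fs 0 t) (fst t) t)
    (hfstt : ∀ t, HasDerivAt fst (fstt t) t) {r₁ r₂ B M₂ M₃ : ℝ} (hr₁ : 0 < r₁) (hr₂ : 0 < r₂) (hr₂1 : r₂ ≤ 1)
    (hB : ∀ t ∈ Icc (0 : ℝ) 1, |f r₁ t - f r₁ 0 - f 0 t + f 0 0| ≤ B) (hM₂ : ∀ s ∈ Icc (0 : ℝ) r₁, ∀ t ∈ Icc (0 : ℝ) 1, |fss s t| ≤ M₂)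
    (hM₃ : ∀ t ∈ Icc (0 : ℝ) 1, |fstt t| ≤ M₃) : |fst 0| ≤ (B / r₁ + M₂ * r₁) / r₂ + M₃ * r₂ / 2 := by
  -- Step 1: for each `t ∈ [0,1]`, the increment in `s` of `g_t = f(·,t) − f(·,0)` gives `|fs 0 t − fs 0 0| ≤ B/r₁ + M₂r₁`
  have step1 : ∀ t ∈ Icc (0 : ℝ) 1, |fs 0 t - fs 0 0| ≤ B / r₁ + M₂ * r₁ := by
    intro t ht
    have h0 : (0 : ℝ) ∈ Icc (0 : ℝ) 1 := ⟨le_rfl, zero_le_one⟩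
    have h := abs_deriv_le_of_increment (g := fun s => f s t - f s 0) (g' := fun s => fs s t - fs s 0) (g'' := fun s => fss s t - fss s 0)
      (fun s => (hfs s t).sub (hfs s 0)) (fun s => (hfss s t).sub (hfss s 0)) hr₁ (B := B) (M := 2 * M₂)
      (by
        have e : f r₁ t - f r₁ 0 - (f 0 t - f 0 0) = f r₁ t - f r₁ 0 - f 0 t + f 0 0 := by ring
        rw [e]
        exact hB t ht)
      (fun s hs => by
        calc |fss s t - fss s 0| ≤ |fss s t| + |fss s 0| := abs_sub _ _
          _ ≤ M₂ + M₂ := add_le_add (hM₂ s hs t ht) (hM₂ s hs 0 h0)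
          _ = 2 * M₂ := by ring)
    have e : 2 * M₂ * r₁ / 2 = M₂ * r₁ := by ring
    rw [e] at h
    exact h
  -- Step 2: `m(t) = fs 0 t − fs 0 0` has `m(0) = 0`, `|m(r₂)| ≤ B/r₁ + M₂r₁`, `m' = fst`, `|m''| ≤ M₃`
  have h := abs_deriv_le_of_increment (g := fun t => fs 0 t - fs 0 0) (g' := fst) (g'' := fstt) (fun t => (hfst t).sub_const _) hfstt hr₂
    (B := B / r₁ + M₂ * r₁) (M := M₃)
    (by
      rw [sub_self, sub_zero]
      exact step1 r₂ ⟨hr₂.le, hr₂1⟩)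
    (fun t ht => hM₃ t ⟨ht.1, ht.2.trans hr₂1⟩)
  exact h

/-! ## §3. Toy -/

/-- Toy (§1): the linear function `g(x) = 3x` (`g' = 3`, `g'' = 0`) with `r = 1`: `|g'(0)| = 3 ≤ |g(1) − g(0)|∕1 + 0`. -/
example : |(fun _ : ℝ => (3 : ℝ)) 0| ≤ |(fun x : ℝ => 3 * x) 1 - (fun x : ℝ => 3 * x) 0| / 1 + 0 * 1 / 2 :=
  abs_deriv_le_of_increment (g := fun x : ℝ => 3 * x) (g' := fun _ => 3) (g'' := fun _ => 0)
    (fun x => ((hasDerivAt_id x).const_mul (3 : ℝ)).congr_deriv (mul_one 3)) (fun x => hasDerivAt_const x 3) one_pos le_rfl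
    (fun x _ => by rw [abs_zero])

/-! ## §4. Local versions: differentiability letters on the relevant intervals only -/

/-- **MVT for the derivative, local letters**: `HasDerivAt g' (g'' x) x` and `|g''| ≤ M` for `x ∈ [0,r]` ⟹ `|g'(x) − g'(0)| ≤ M·x` on `[0,r]`.
[folklore] -/
theorem abs_sub_sub_mul_le_on {g' g'' : ℝ → ℝ} {r : ℝ} (hg' : ∀ x ∈ Icc (0 : ℝ) r, HasDerivAt g' (g'' x) x) {M : ℝ}
    (hM : ∀ x ∈ Icc (0 : ℝ) r, |g'' x| ≤ M) {x : ℝ} (hx : x ∈ Icc (0 : ℝ) r) : |g' x - g' 0| ≤ M * x := by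
  have h := norm_image_sub_le_of_norm_deriv_le_segment' (f := g') (f' := g'') (a := 0) (b := x)
    (fun y hy => (hg' y ⟨hy.1, hy.2.trans hx.2⟩).hasDerivWithinAt) (fun y hy => by
      rw [Real.norm_eq_abs]
      exact hM y ⟨hy.1, hy.2.le.trans hx.2⟩) x (right_mem_Icc.2 hx.1)
  rw [Real.norm_eq_abs, sub_zero] at h
  exact h

/-- **A DERIVATIVE FROM AN INCREMENT, local letters**: `HasDerivAt g (g' x) x`, `HasDerivAt g' (g'' x) x`, `|g''(x)| ≤ M` for `x ∈ [0,r]`,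
`0 < r`, `|g(r) − g(0)| ≤ B` ⟹ `|g'(0)| ≤ B∕r + ½M·r`. [folklore] -/
theorem abs_deriv_le_of_increment_on {g g' g'' : ℝ → ℝ} {r : ℝ} (hg : ∀ x ∈ Icc (0 : ℝ) r, HasDerivAt g (g' x) x)
    (hg' : ∀ x ∈ Icc (0 : ℝ) r, HasDerivAt g' (g'' x) x) {B M : ℝ} (hr : 0 < r) (hB : |g r - g 0| ≤ B)
    (hM : ∀ x ∈ Icc (0 : ℝ) r, |g'' x| ≤ M) : |g' 0| ≤ B / r + M * r / 2 := by
  have hD : Convex ℝ (Icc (0 : ℝ) r) := convex_Icc 0 r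
  have hint : interior (Icc (0 : ℝ) r) = Ioo 0 r := interior_Icc
  have hsq : ∀ x : ℝ, HasDerivAt (fun x : ℝ => M * x ^ 2 / 2) (M * x) x := fun x =>
    (((hasDerivAt_pow 2 x).const_mul M).div_const 2).congr_deriv (by
      rw [show (2 : ℕ) - 1 = 1 from rfl, pow_one]
      push_cast
      ring)
  have hψd : ∀ x ∈ Icc (0 : ℝ) r, HasDerivAt (fun x => g x - g 0 - x * g' 0 - M * x ^ 2 / 2) (g' x - g' 0 - M * x) x := fun x hx =>
    ((((hg x hx).sub_const (g 0)).sub ((hasDerivAt_id' x).mul_const (g' 0))).sub (hsq x)).congr_deriv (by ring)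
  have hχd : ∀ x ∈ Icc (0 : ℝ) r, HasDerivAt (fun x => g x - g 0 - x * g' 0 + M * x ^ 2 / 2) (g' x - g' 0 + M * x) x := fun x hx =>
    ((((hg x hx).sub_const (g 0)).sub ((hasDerivAt_id' x).mul_const (g' 0))).add (hsq x)).congr_deriv (by ring)
  have hdev : ∀ x ∈ Ioo (0 : ℝ) r, |g' x - g' 0| ≤ M * x := fun x hx => abs_sub_sub_mul_le_on hg' hM ⟨hx.1.le, hx.2.le⟩
  have hIoo : ∀ x ∈ Ioo (0 : ℝ) r, x ∈ Icc (0 : ℝ) r := fun x hx => ⟨hx.1.le, hx.2.le⟩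
  have hψ := hD.image_sub_le_mul_sub_of_deriv_le (f := fun x => g x - g 0 - x * g' 0 - M * x ^ 2 / 2)
    (fun x hx => (hψd x hx).continuousAt.continuousWithinAt) (fun x hx => by
      rw [hint] at hx
      exact (hψd x (hIoo x hx)).differentiableAt.differentiableWithinAt) (C := 0)
    (fun x hx => by
      rw [hint] at hx
      rw [(hψd x (hIoo x hx)).deriv]
      linarith [(abs_le.1 (hdev x hx)).2])
    0 (left_mem_Icc.2 hr.le) r (right_mem_Icc.2 hr.le) hr.le
  have hχ := hD.mul_sub_le_image_sub_of_le_deriv (f := fun x => g x - g 0 - x * g' 0 + M * x ^ 2 / 2)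
    (fun x hx => (hχd x hx).continuousAt.continuousWithinAt) (fun x hx => by
      rw [hint] at hx
      exact (hχd x (hIoo x hx)).differentiableAt.differentiableWithinAt) (C := 0)
    (fun x hx => by
      rw [hint] at hx
      rw [(hχd x (hIoo x hx)).deriv]
      linarith [(abs_le.1 (hdev x hx)).1])
    0 (left_mem_Icc.2 hr.le) r (right_mem_Icc.2 hr.le) hr.le
  simp only [sub_self, zero_mul, mul_zero, zero_pow two_ne_zero, zero_div, sub_zero, add_zero] at hψ hχ
  have hB1 := (abs_le.1 hB).1
  have hB2 := (abs_le.1 hB).2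
  have hr0 : r ≠ 0 := hr.ne'
  have e : (B + M * r ^ 2 / 2) / r = B / r + M * r / 2 := by
    field_simp
  rw [abs_le, ← e]
  constructor
  · rw [neg_le, le_div_iff₀ hr]
    linarith
  · rw [le_div_iff₀ hr]
    linarith

/-- **A MIXED DERIVATIVE FROM MIXED DIFFERENCES, local letters**: as `abs_mixedDeriv_le_of_differences` with `∂_sf = fs`, `∂_sfs = fss` asked
only on `[0,r₁] × [0,1]` and `∂_t(fs 0 ·) = fst`, `∂_tfst = fstt` only on `[0,1]` (`0 < r₁`, `0 < r₂ ≤ 1`) ⟹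
`|fst 0| ≤ (B∕r₁ + M₂r₁)∕r₂ + ½M₃r₂`. [folklore] -/
theorem abs_mixedDeriv_le_of_differences_on {f fs fss : ℝ → ℝ → ℝ} {fst fstt : ℝ → ℝ} {r₁ r₂ : ℝ} (hr₁ : 0 < r₁) (hr₂ : 0 < r₂)
    (hr₂1 : r₂ ≤ 1) (hfs : ∀ s ∈ Icc (0 : ℝ) r₁, ∀ t ∈ Icc (0 : ℝ) 1, HasDerivAt (fun s => f s t) (fs s t) s)
    (hfss : ∀ s ∈ Icc (0 : ℝ) r₁, ∀ t ∈ Icc (0 : ℝ) 1, HasDerivAt (fun s => fs s t) (fss s t) s)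
    (hfst : ∀ t ∈ Icc (0 : ℝ) 1, HasDerivAt (fun t => fs 0 t) (fst t) t) (hfstt : ∀ t ∈ Icc (0 : ℝ) 1, HasDerivAt fst (fstt t) t)
    {B M₂ M₃ : ℝ} (hB : ∀ t ∈ Icc (0 : ℝ) 1, |f r₁ t - f r₁ 0 - f 0 t + f 0 0| ≤ B)
    (hM₂ : ∀ s ∈ Icc (0 : ℝ) r₁, ∀ t ∈ Icc (0 : ℝ) 1, |fss s t| ≤ M₂) (hM₃ : ∀ t ∈ Icc (0 : ℝ) 1, |fstt t| ≤ M₃) :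
    |fst 0| ≤ (B / r₁ + M₂ * r₁) / r₂ + M₃ * r₂ / 2 := by
  have h0 : (0 : ℝ) ∈ Icc (0 : ℝ) 1 := ⟨le_rfl, zero_le_one⟩
  -- Step 1
  have step1 : ∀ t ∈ Icc (0 : ℝ) 1, |fs 0 t - fs 0 0| ≤ B / r₁ + M₂ * r₁ := by
    intro t ht
    have h := abs_deriv_le_of_increment_on (g := fun s => f s t - f s 0) (g' := fun s => fs s t - fs s 0)
      (g'' := fun s => fss s t - fss s 0) (fun s hs => (hfs s hs t ht).sub (hfs s hs 0 h0)) (fun s hs => (hfss s hs t ht).sub (hfss s hs 0 h0))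
      hr₁ (B := B) (M := 2 * M₂)
      (by
        have e : f r₁ t - f r₁ 0 - (f 0 t - f 0 0) = f r₁ t - f r₁ 0 - f 0 t + f 0 0 := by ring
        rw [e]
        exact hB t ht)
      (fun s hs => by
        calc |fss s t - fss s 0| ≤ |fss s t| + |fss s 0| := abs_sub _ _
          _ ≤ M₂ + M₂ := add_le_add (hM₂ s hs t ht) (hM₂ s hs 0 h0)
          _ = 2 * M₂ := by ring)
    have e : 2 * M₂ * r₁ / 2 = M₂ * r₁ := by ring
    rw [e] at h
    exact h
  -- Step 2 on `[0, r₂] ⊆ [0, 1]`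
  have hsub : ∀ t ∈ Icc (0 : ℝ) r₂, t ∈ Icc (0 : ℝ) 1 := fun t ht => ⟨ht.1, ht.2.trans hr₂1⟩
  exact abs_deriv_le_of_increment_on (g := fun t => fs 0 t - fs 0 0) (g' := fst) (g'' := fstt)
    (fun t ht => (hfst t (hsub t ht)).sub_const _) (fun t ht => hfstt t (hsub t ht)) hr₂ (B := B / r₁ + M₂ * r₁) (M := M₃)
    (by
      rw [sub_self, sub_zero]
      exact step1 r₂ ⟨hr₂.le, hr₂1⟩)
    (fun t ht => hM₃ t (hsub t ht))

end Summit.QuantumFields.BalabanUV.T4Continuum.NE7b.SupMixedDerivativeFromDifferences
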